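import Mathlib
import HarnessLib
import Literature.Analysis.FluidPDE.Tao2016AveragedNS.LocalCascadeSolutions
import Literature.Analysis.FluidPDE.Tao2016AveragedNS.RenormalisedCascadeWaves
import Literature.Analysis.FluidPDE.Tao2016AveragedNS.SelfSimilarCascadeBlowup
import Literature.Analysis.FluidPDE.Tao2016AveragedNS.ViscousEternalSolutions
import Literature.Analysis.FluidPDE.Tao2016AveragedNS.BoundedEternalSolutions
import Summits.NavierStokesRegularity.NavierStokesRegularity.Theses.TaoLadderRungTwoBreak
import Summits.NavierStokesRegularity.NavierStokesRegularity.Theorems.TaoLadderRungTwoBreakEternalRigidityViscBddOneDefs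
import Summits.NavierStokesRegularity.NavierStokesRegularity.Theorems.TaoLadderRungTwoBreakEternalRigidityViscBddOneStubViscousBlowup
import Summits.NavierStokesRegularity.NavierStokesRegularity.Theorems.TaoLadderRungTwoBreakEternalRigidityViscBddOneLimitOfEnvelope
import Summits.NavierStokesRegularity.NavierStokesRegularity.Theorems.WakeRatchetMinimalViscousBlowupTypeOneClockOfFiredClock

/-!
# Crux `TaoLadderRungTwoBreak.EternalRigidityViscBddOne` (stmt-NavierStokesRegularity-20420): BOTH open stubs (ω3) `stub_typeOne`
# and (ω4) `stub_eternalLimitViscBdd` reduce to ONE pair of estimates on sub-threshold viscous blow-ups — the a=1 ENERGY ENVELOPE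
# and the FIRED FRONT CLOCK — and given the envelope, TYPE I ⟺ FIRED FRONT CLOCK

Continuation of `…LimitOfEnvelope` (this hand).  With the tree's WakeRatchet lemma `typeOneClock_of_firedClock` (S5 ⇐ (FC′)):

* `typeOne_of_envelope_of_firedClock` — **(ω3) ⇐ envelope + (FC′)**: a regular viscous trajectory that blows up at `t⋆`, carries an a=1
  energy envelope `λⁿ‖X_n(t)‖² ≤ C` and obeys the fired front clock «once shell `m` has fired at level `ν²/(32768λ^{16})`, at most `K/λ^{2m}`
  of life remains» is TYPE I (`TypeOne ε₀ X t⋆`, componentwise) — every `ε₀ > 0`, every table of `InTableClass R`;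
* `firedClock_iff_typeOne_of_envelope` — given the envelope (and blow-up), **TypeOne ⟺ (FC′)** (⇒ is `firedClock_of_typeOne`);
* `eternalRigidityViscBddOne_of_envelope_firedClock` — **the crux BY NAME from ONE hypothesis**: «below a threshold, every blowing-up regular
  trajectory of the exact `ν`-viscous lattice of an E₂(R) table from a one-shell datum carries an a=1 energy envelope and a fired front
  clock» ⇒ `EternalRigidityViscBddOne` ((ω1) landed `stub_viscousBlowup`; (ω3) by the first bullet; (ω4) by `eternalLimitViscBdd_of_envelope`).

REPAIR CENSUS for ⟨20420⟩ along the registered line, kernel-precise: {(ω3), (ω4)} ⟸ {envelope ∧ fired front clock for EVERY sub-threshold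
blow-up} — the «for every blow-up» is the cell's N-39 risk (type II / chaotic cascades); route WakeRatchet asks the same two estimates for ONE
selected trajectory (threshold viscosity, ⟨22743⟩), which is why that decomposition is the productive one for this SHARED decl.

HONEST LABEL: reductions over landed theorems; MODEL lattice ODEs of Tao 2016 §4 only; ⟨20420⟩, (ω3), (ω4), ⟨22743⟩ and every NS statement
remain OPEN; nothing here bears on the summit.
-/

noncomputable section

-- the summit and its single sub-problem share the name (CONVENTIONS §1)
set_option linter.dupNamespace false

namespace Summit.NavierStokesRegularity.NavierStokesRegularity.Theorems.EternalRigidityViscBddOne.Birth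

open Set Filter Topology MeasureTheory
open Literature.Analysis.FluidPDE Literature.Analysis.FluidPDE.TaoCascade
open Summit.NavierStokesRegularity.NavierStokesRegularity.Theses.TaoLadderRungTwoBreak

/-- **(ω3) ⇐ envelope + fired front clock.**  For every `ε₀ > 0`, every table of `InTableClass R` (`R ≥ 1`) and `ν > 0`: a regular solution
of the exact `ν`-viscous lattice on `[0,t⋆)` from a one-shell datum (`ViscousUpTo`) that blows up at `t⋆` (`BlowsUpAt`), carries the a=1
energy envelope `(1+ε₀)^n ‖X_n(t)‖² ≤ C` and obeys the fired front clock (FC′) at level `ν²/(32768(1+ε₀)^{16})` is TYPE I.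
(WakeRatchet `typeOneClock_of_firedClock` on the family with negative shells zeroed at all times; coordinates are bounded by the
Euclidean shell norm.)
[cite: Tao2016AveragedNS, §4 Lemma 4.1 (4.5), §5; BarbatoMorandinRomito2011, §3.1; tree WakeRatchet S5 ⇐ (FC′)] -/
theorem typeOne_of_envelope_of_firedClock {R ε₀ ν : ℝ} (hR : 1 ≤ R) (hε₀ : 0 < ε₀) (hν : 0 < ν)
    {α : Fin 4 → Fin 4 → Fin 4 → ℤ × ℤ × ℤ → ℝ} {X₀ : Fin 4 → ℝ} (hα : InTableClass R α)
    {X : Fin 4 → ℤ → ℝ → ℝ} {tStar : ℝ} (hV : ViscousUpTo ε₀ ν α X₀ X tStar) (hB : BlowsUpAt ε₀ X tStar)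
    (hE : ∃ C : ℝ, ∀ (n : ℤ) (t : ℝ), 0 ≤ t → t < tStar → (1 + ε₀) ^ n * ‖shellVec X n t‖ ^ 2 ≤ C)
    (hFC : ∃ K : ℝ, ∀ (m : ℕ) (t : ℝ), 0 ≤ t → t < tStar →
      (∃ s, 0 ≤ s ∧ s ≤ t ∧ 1 / (32768 * (1 + ε₀) ^ 16) * ν ^ 2 ≤ (1 + ε₀) ^ m * ‖shellVec X m s‖ ^ 2) →
      tStar - t ≤ K / (1 + ε₀) ^ (2 * m)) :
    TypeOne ε₀ X tStar := by
  obtain ⟨C₃, hC₃⟩ := hE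
  obtain ⟨K, hK⟩ := hFC
  have hT : 0 < tStar := hV.pos
  -- the family with the negative shells zeroed at ALL times
  set Z : Fin 4 → ℤ → ℝ → ℝ := fun i n t => if n < 0 then 0 else X i n t with hZ
  have hZX : ∀ (j : Fin 4) (k : ℤ) (t : ℝ), 0 ≤ t → t < tStar → Z j k t = X j k t := by
    intro j k t ht0 htT
    by_cases hk : k < 0
    · simp only [hZ, if_pos hk]; exact (hV.noLow j k t hk ht0 htT).symm
    · simp only [hZ, if_neg hk]
  have hZneg : ∀ (j : Fin 4) (k : ℤ) (t : ℝ), k < 0 → Z j k t = 0 := fun j k t hk => by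
    simp only [hZ, if_pos hk]
  have hZnn : ∀ (j : Fin 4) (k : ℤ), ¬ k < 0 → Z j k = X j k := fun j k hk => by
    funext t; simp only [hZ, if_neg hk]
  have hsv : ∀ (k : ℤ) (t : ℝ), 0 ≤ t → t < tStar → shellVec Z k t = shellVec X k t := by
    intro k t ht0 htT
    ext j
    rw [shellVec_apply, shellVec_apply, hZX j k t ht0 htT]
  have hcdZ : ∀ i n, ContDiffOn ℝ 1 (Z i n) (Ico 0 tStar) := by
    intro i n
    by_cases hn : n < 0
    · have : Z i n = fun _ => 0 := funext fun t => hZneg i n t hn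
      rw [this]; exact contDiffOn_const
    · rw [hZnn i n hn]; exact hV.contDiffOn i n
  have hinitZ : ∀ i n, Z i n 0 = if n = 0 then X₀ i else 0 := by
    intro i n
    by_cases hn : n < 0
    · rw [hZneg i n 0 hn, if_neg (by omega)]
    · rw [hZnn i n hn]; exact hV.init i n
  have hlowZ : ∀ i n t, n < 0 → Z i n t = 0 := fun i n t hn => hZneg i n t hn
  have hmotZ : ∀ i n t, 0 ≤ t → t < tStar → derivWithin (Z i n) (Ici 0) t =
      quadTerm ε₀ α Z i n t - ν * (1 + ε₀) ^ ((2 : ℝ) * n) * Z i n t := by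
    intro i n t ht0 htT
    have hq : quadTerm ε₀ α Z i n t = quadTerm ε₀ α X i n t :=
      MinimalViscousBlowup.ThresholdRay.quadTerm_congr_at (fun j k => hZX j k t ht0 htT) i n
    by_cases hn : n < 0
    · have hz : Z i n = fun _ => 0 := funext fun s => hZneg i n s hn
      have hev : (X i n) =ᶠ[𝓝[Ici 0] t] (fun _ => (0 : ℝ)) := by
        have hmem : Ici 0 ∩ Iio tStar ∈ 𝓝[Ici 0] t := inter_mem_nhdsWithin (Ici 0) (Iio_mem_nhds htT)
        filter_upwards [hmem] with s hs using hV.noLow i n s hn hs.1 hs.2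
      have hdX : derivWithin (X i n) (Ici 0) t = derivWithin (fun _ => (0 : ℝ)) (Ici 0) t :=
        hev.derivWithin_eq (hV.noLow i n t hn ht0 htT)
      have hZ0 : Z i n t = 0 := hZneg i n t hn
      have hX0 : X i n t = 0 := hV.noLow i n t hn ht0 htT
      have hd : derivWithin (Z i n) (Ici 0) t = derivWithin (X i n) (Ici 0) t := by rw [hz, ← hdX]
      rw [hd, hV.motion i n t ht0 htT, hq, hZ0, hX0]
    · rw [hZnn i n hn, hq]
      exact hV.motion i n t ht0 htT
  have hregZ : ∀ T' : ℝ, 0 < T' → T' < tStar → ∃ M : ℝ, ∀ t : ℝ, 0 ≤ t → t ≤ T' →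
      ∀ (i : Fin 4) (n : ℤ), (1 + (1 + ε₀) ^ ((10 : ℝ) * n)) * |Z i n t| ≤ M := by
    intro T' hT' hT'T
    obtain ⟨M, hM⟩ := hV.apriori T' hT' hT'T
    exact ⟨M, fun t ht0 htT' i n => by
      rw [hZX i n t ht0 (lt_of_le_of_lt htT' hT'T)]; exact hM t ⟨ht0, htT'⟩ i n⟩
  have hblowZ : ∀ M : ℝ, ∃ t : ℝ, 0 ≤ t ∧ t < tStar ∧
      ∃ (i : Fin 4) (n : ℤ), M < (1 + (1 + ε₀) ^ ((10 : ℝ) * n)) * |Z i n t| := by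
    intro M
    obtain ⟨t, ht0, htT, i, n, hlt⟩ := hB M
    exact ⟨t, ht0, htT, i, n, by rw [hZX i n t ht0 htT]; exact hlt⟩
  have henvZ : ∀ (n : ℤ) (t : ℝ), 0 ≤ t → t < tStar → (1 + ε₀) ^ n * ‖shellVec Z n t‖ ^ 2 ≤ C₃ := by
    intro n t ht0 htT
    rw [hsv n t ht0 htT]; exact hC₃ n t ht0 htT
  have hFCZ : ∃ K : ℝ, ∀ (m : ℕ) (t : ℝ), 0 ≤ t → t < tStar →
      (∃ s, 0 ≤ s ∧ s ≤ t ∧ 1 / (32768 * (1 + ε₀) ^ 16) * ν ^ 2 ≤ (1 + ε₀) ^ m * ‖shellVec Z m s‖ ^ 2) →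
      tStar - t ≤ K / (1 + ε₀) ^ (2 * m) := by
    refine ⟨K, fun m t ht0 htT ⟨s, hs0, hst, hfire⟩ => hK m t ht0 htT ⟨s, hs0, hst, ?_⟩⟩
    rw [← hsv m s hs0 (lt_of_le_of_lt hst htT)]; exact hfire
  obtain ⟨C', hclk, -⟩ := MinimalViscousBlowup.ThresholdRay.typeOneClock_of_firedClock ε₀ hε₀ R hR α X₀ hα ν tStar C₃ Z
    hν hT hcdZ hinitZ hlowZ hmotZ hregZ hblowZ henvZ hFCZ
  refine ⟨C', fun t ht0 htT i n => ?_⟩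
  have hΛ : 0 ≤ bigLam ε₀ ^ n := (zpow_pos (bigLam_pos (by linarith)) n).le
  have hgap : 0 ≤ tStar - t := by linarith
  have hcoord : |X i n t| ≤ ‖shellVec X n t‖ := by
    have h := PiLp.norm_apply_le (shellVec X n t) i
    rwa [shellVec_apply, Real.norm_eq_abs] at h
  calc bigLam ε₀ ^ n * |X i n t| * (tStar - t)
      ≤ bigLam ε₀ ^ n * ‖shellVec X n t‖ * (tStar - t) :=
        mul_le_mul_of_nonneg_right (mul_le_mul_of_nonneg_left hcoord hΛ) hgap
    _ = bigLam ε₀ ^ n * (tStar - t) * ‖shellVec Z n t‖ := by rw [hsv n t ht0 htT]; ring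
    _ ≤ C' := hclk n t ht0 htT

/-- **Given the envelope (and blow-up), TYPE I ⟺ FIRED FRONT CLOCK** for a regular viscous trajectory on `[0,t⋆)`.
[cite: Tao2016AveragedNS, §4 (4.1), Lemma 4.1 (4.5), §5; tree: `firedClock_of_typeOne`, WakeRatchet S5 ⇐ (FC′)] -/
theorem firedClock_iff_typeOne_of_envelope {R ε₀ ν : ℝ} (hR : 1 ≤ R) (hε₀ : 0 < ε₀) (hν : 0 < ν)
    {α : Fin 4 → Fin 4 → Fin 4 → ℤ × ℤ × ℤ → ℝ} {X₀ : Fin 4 → ℝ} (hα : InTableClass R α)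
    {X : Fin 4 → ℤ → ℝ → ℝ} {tStar : ℝ} (hV : ViscousUpTo ε₀ ν α X₀ X tStar) (hB : BlowsUpAt ε₀ X tStar)
    (hE : ∃ C : ℝ, ∀ (n : ℤ) (t : ℝ), 0 ≤ t → t < tStar → (1 + ε₀) ^ n * ‖shellVec X n t‖ ^ 2 ≤ C) :
    (∃ K : ℝ, ∀ (m : ℕ) (t : ℝ), 0 ≤ t → t < tStar →
      (∃ s, 0 ≤ s ∧ s ≤ t ∧ 1 / (32768 * (1 + ε₀) ^ 16) * ν ^ 2 ≤ (1 + ε₀) ^ m * ‖shellVec X m s‖ ^ 2) →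
      tStar - t ≤ K / (1 + ε₀) ^ (2 * m)) ↔ TypeOne ε₀ X tStar := by
  constructor
  · exact typeOne_of_envelope_of_firedClock hR hε₀ hν hα hV hB hE
  · intro hI
    obtain ⟨C₁, hC₁⟩ := clock_of_typeOne hε₀ hI
    have hc : (0 : ℝ) < 1 / (32768 * (1 + ε₀) ^ 16) := by
      have : (0 : ℝ) < 1 + ε₀ := by linarith
      positivity
    exact ⟨_, firedClock_of_typeOne hε₀ hν hc hC₁⟩

/-- **The crux from ONE hypothesis on sub-threshold blow-ups.**  If for every spread `R ≥ 1` there is a threshold below which every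
blowing-up regular trajectory of the exact `ν`-viscous lattice (`ν > 0`) of an E₂(R) table from a one-shell datum carries an a=1 ENERGY
ENVELOPE and a FIRED FRONT CLOCK, then `EternalRigidityViscBddOne` ⟨20420⟩ holds: (ω1) `stub_viscousBlowup` (landed), (ω3) by
`typeOne_of_envelope_of_firedClock`, (ω4) by `eternalLimitViscBdd_of_envelope`.
[cite: Tao2016AveragedNS, §4 Thm. 4.2 with Lemma 4.1, §5, §6.4; cell composition] -/
theorem eternalRigidityViscBddOne_of_envelope_firedClock
    (h : ∀ R : ℝ, 1 ≤ R → ∃ εs : ℝ, 0 < εs ∧ ∀ ε₀ : ℝ, 0 < ε₀ → ε₀ ≤ εs →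
      ∀ (α : Fin 4 → Fin 4 → Fin 4 → ℤ × ℤ × ℤ → ℝ) (X₀ : Fin 4 → ℝ), InTableClass R α →
        ∀ ν : ℝ, 0 < ν → ∀ (X : Fin 4 → ℤ → ℝ → ℝ) (tStar : ℝ),
          ViscousUpTo ε₀ ν α X₀ X tStar → BlowsUpAt ε₀ X tStar →
            (∃ C : ℝ, ∀ (n : ℤ) (t : ℝ), 0 ≤ t → t < tStar → (1 + ε₀) ^ n * ‖shellVec X n t‖ ^ 2 ≤ C) ∧
            (∃ K : ℝ, ∀ (m : ℕ) (t : ℝ), 0 ≤ t → t < tStar →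
              (∃ s, 0 ≤ s ∧ s ≤ t ∧ 1 / (32768 * (1 + ε₀) ^ 16) * ν ^ 2 ≤ (1 + ε₀) ^ m * ‖shellVec X m s‖ ^ 2) →
              tStar - t ≤ K / (1 + ε₀) ^ (2 * m))) :
    EternalRigidityViscBddOne := by
  intro R hR
  obtain ⟨εs, hεs, H⟩ := h R hR
  refine ⟨εs, hεs, fun ε₀ hε₀ hle α X₀ hα hNG => ?_⟩
  obtain ⟨κ, hκ, hnot⟩ := (noGlobalCascade_iff_kappa hε₀).1 hNG
  have h2pos : 0 < Real.sqrt 2 := Real.sqrt_pos.2 two_pos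
  have hν : 0 < κ / Real.sqrt 2 := div_pos hκ h2pos
  have hνκ : κ / Real.sqrt 2 * Real.sqrt 2 ≤ κ := by rw [div_mul_cancel₀ κ (ne_of_gt h2pos)]
  obtain ⟨X, tStar, hV, hB⟩ := stub_viscousBlowup R hR ε₀ hε₀ α X₀ hα κ (κ / Real.sqrt 2) hν hνκ hnot
  obtain ⟨hE, hFC⟩ := H ε₀ hε₀ hle α X₀ hα _ hν X tStar hV hB
  have hI : TypeOne ε₀ X tStar := typeOne_of_envelope_of_firedClock hR hε₀ hν hα hV hB hE hFC
  exact eternalLimitViscBdd_of_envelope hR hε₀ hν hα hV hB hI hE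

end Summit.NavierStokesRegularity.NavierStokesRegularity.Theorems.EternalRigidityViscBddOne.Birth

end
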